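import Mathlib

/-!
# SoloBlindConjugateDualSign — the sign of the conjugate-self-dual block `BC_K(ρ) ⊗ μ`
# (PROPOSITION W♭-U, step (U2)) by an EXPLICIT bilinear form, and the parity bookkeeping

Solo seat `solo-Langlands-blind`, session 33 (cold audit of PROPOSITION W♭-U, the unitary-group
parity lock; referee note R62: "the one place where a slip EXCHANGES the parities").

SETTING.  `K/ℚ` imaginary quadratic, `G_K ⊂ G_ℚ` of index `2`, `s ∈ G_ℚ ∖ G_K`;
`ρ : G_ℚ → GL₂(ℂ)` with `det ρ = ω`; `μ : G_K → ℂˣ` a character with `μ · μ^c = ω⁻¹|_{G_K}`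
(`μ^c(h) = μ(s h s⁻¹)`), equivalently `μ ∘ Ver = μ|_{𝔸_ℚ^×} = ω⁻¹ η^e`, `e ∈ {0, 1}`, `η = η_{K/ℚ}`;
since `Ver(s) = s²` and `η(s) = −1`, `μ(s²) = ω(s)⁻¹ (−1)^e`.  Put `σ = ρ|_{G_K} ⊗ μ`,
`σ^c(h) = σ(s h s⁻¹) = ρ(s) ρ(h) ρ(s)⁻¹ · μ^c(h)`.

THE FORM.  `B(x, y) = x₀ y₁ − x₁ y₀` (so `B(Mx, My) = det M · B(x, y)`), and
`B'(x, y) := B(x, ρ(s)⁻¹ y)`.  Then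

* INVARIANCE (`twistForm_invariant`): `B'(σ(h) x, σ^c(h) y) = B'(x, y)` for all `h ∈ G_K`
  — uses only `μ(h) μ^c(h) det ρ(h) = 1`;  so `B'` exhibits `σ^c ≅ σ^∨`, i.e. `σ` is conjugate-self-dual;
* SIGN (`twistForm_sign`): `B'(y, x) = −ε · B'(x, σ(s²) y)` with `ε := μ(s²) det ρ(s) = (−1)^e`
  — uses only `ε² = 1`.  In the convention of [GGP12, §3] (`B(y, x) = b · B(x, σ(s²) y)`, pinned by
  `N = 1`: for a character `χ` of `G_K` with `χ^c = χ⁻¹` and `B = xy` one gets `b = χ(s²)⁻¹ = χ(Ver s)⁻¹`,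
  so `b = +1` iff `χ|_{𝔸_ℚ^×} = 1`, which IS "conjugate-orthogonal" for `U(1)`), the sign of `σ` is
  `b(σ) = −ε = (−1)^{e+1}`:  conjugate-ORTHOGONAL iff `e = 1`, conjugate-SYMPLECTIC iff `e = 0`.

This is a second, `L`-function-free proof of the sign used in W♭-U (U2), where it was obtained from
`As⁺(ρ|_{G_K} ⊗ μ) = Sym²ρ ⊗ ω⁻¹η^e ⊕ η^{e+1}` and "pole of `L(s, σ, As⁺)` ⟺ conjugate-orthogonal"
[GGP12, §7], [Mok2012, Thm. 2.5.4]; the two agree.  (For `ω = 1`, `μ = 1`: `e = 0`, `σ = ρ|_{G_K}` with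
`ρ` valued in `SL₂ = Sp₂` is conjugate-symplectic, as it must be.)  The form-theoretic proof is valid
for every `ρ` (dihedral or not) and every coefficient ring.

BOOKKEEPING (`cosetMatch_iff_odd`, `decide` over `ZMod 2`).  With `t = [ρ odd] = [ω_∞(−1) = −1]`,
`μ_∞ = χ_k = (z/|z|)^k` on `ℂ^× = K_∞^×`:  `μ|_{ℝ^×}(−1) = (−1)^k = ω_∞(−1) η_∞(−1)^e` gives
`k ≡ t + e (mod 2)` (`η_∞ = sgn`);  the discreteness condition `Ψ₂(U_N)` for the block `σ ⊠ S_a`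
(sign `b(σ) · (−1)^{a−1} = (−1)^{N−1}`, [Mok2012, §2.4]) gives `e + 1 + a − 1 ≡ N − 1`, i.e.
`e ≡ N − 1 − a`;  the block's archimedean exponents `(k + a − 1)/2 − j` lie in the integral coset
`(N − 1)/2 + ℤ` of `U(p, q)` (necessary for Betti and for `(𝔮_h, K_h)`-coherent cohomology) iff
`k + a − 1 ≡ N − 1`, and the theorem says this happens iff `t = 1`:  ρ ODD.  An even `ρ` is locked
out of every unitary Shimura variety over `K` through every such block, for every `N`, `a`, `μ`,
signature and complement — PROPOSITION W♭-U of the seat's paper (§5 item 17), whose only other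
inputs are LEMMA M (Casselman–Osborne) and "members of `Π(ψ_∞)` have the infinitesimal character
of `φ_{ψ_∞}`".

Not a step toward the summit `Summit.Langlands`; it certifies the algebra of one wall of the
seat's sharpest statement (census item 4, the parity front).
[cite: GanGrossPrasad2012, §3 and §7 (Astérisque 346)] [cite: Mok2012, Thm. 2.5.4 and §2.4 (arXiv:1206.0882; Mem. AMS 1108, 2015)]
-/

namespace Summit.Langlands.Langlands.Theorems.SoloBlind

open Matrix

section Form

variable {R : Type*} [CommRing R]

/-- The standard alternating form on `R²`: `B(x, y) = x₀ y₁ − x₁ y₀`. -/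
def altForm (x y : Fin 2 → R) : R := x 0 * y 1 - x 1 * y 0

/-- `B` is alternating: `B(y, x) = −B(x, y)`. [folklore] -/
theorem altForm_swap (x y : Fin 2 → R) : altForm y x = -altForm x y := by
  unfold altForm; ring

/-- `B` is linear in the first variable (scalars). [folklore] -/
theorem altForm_smul_left (c : R) (x y : Fin 2 → R) : altForm (c • x) y = c * altForm x y := by
  simp only [altForm, Pi.smul_apply, smul_eq_mul]; ring

/-- `B` is linear in the second variable (scalars). [folklore] -/
theorem altForm_smul_right (c : R) (x y : Fin 2 → R) : altForm x (c • y) = c * altForm x y := by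
  simp only [altForm, Pi.smul_apply, smul_eq_mul]; ring

/-- `B(Mx, My) = det M · B(x, y)`: the alternating form transforms by the determinant. -/
theorem altForm_mulVec (M : Matrix (Fin 2) (Fin 2) R) (x y : Fin 2 → R) :
    altForm (M *ᵥ x) (M *ᵥ y) = M.det * altForm x y := by
  simp only [altForm, Matrix.mulVec, dotProduct, Fin.sum_univ_two, Matrix.det_fin_two]
  ring

/-- The twisted form `B'(x, y) = B(x, T y)`, `T = ρ(s)⁻¹`. -/
def twistForm (T : Matrix (Fin 2) (Fin 2) R) (x y : Fin 2 → R) : R := altForm x (T *ᵥ y)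

/-- **INVARIANCE.**  `M = ρ(h)`, `S = ρ(s)`, `T = ρ(s)⁻¹`, `m = μ(h)`, `m' = μ^c(h) = μ(s h s⁻¹)` with
`m m' det M = 1` (`μ μ^c = ω⁻¹`).  Then `B'(σ(h) x, σ^c(h) y) = B'(x, y)` where `σ(h) = m M` and
`σ^c(h) = m' · S M S⁻¹`:  the form `B'` is `G_K`-invariant on `σ ⊗ σ^c`, i.e. `σ^c ≅ σ^∨`. -/
theorem twistForm_invariant (M S T : Matrix (Fin 2) (Fin 2) R) (hTS : T * S = 1) (m m' : R)
    (h : m * m' * M.det = 1) (x y : Fin 2 → R) :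
    twistForm T (m • (M *ᵥ x)) (m' • ((S * M * T) *ᵥ y)) = twistForm T x y := by
  have key : T * (S * M * T) = M * T := by
    rw [← Matrix.mul_assoc, ← Matrix.mul_assoc, hTS, Matrix.one_mul]
  unfold twistForm
  rw [Matrix.mulVec_smul, Matrix.mulVec_mulVec, key, ← Matrix.mulVec_mulVec, altForm_smul_left,
    altForm_smul_right, altForm_mulVec]
  calc m * (m' * (M.det * altForm x (T *ᵥ y)))
      = (m * m' * M.det) * altForm x (T *ᵥ y) := by ring
    _ = altForm x (T *ᵥ y) := by rw [h, one_mul]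

/-- **SIGN.**  `S = ρ(s)`, `T = ρ(s)⁻¹`, `u = μ(s²)`, `ε = u · det S` (`= μ(Ver s) ω(s) = (−1)^e`) with
`ε² = 1`.  Then `B'(y, x) = −ε · B'(x, σ(s²) y)`, `σ(s²) = u S²`.  In the convention
`B'(y, x) = b · B'(x, σ(s²) y)` of [GGP12, §3] the conjugate-duality sign of `σ = ρ|_{G_K} ⊗ μ` is
`b = −ε = (−1)^{e+1}`. -/
theorem twistForm_sign (S T : Matrix (Fin 2) (Fin 2) R) (hTS : T * S = 1) (u ε : R)
    (hu : u * S.det = ε) (hε : ε * ε = 1) (x y : Fin 2 → R) :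
    twistForm T y x = -(ε * twistForm T x (u • ((S * S) *ᵥ y))) := by
  have hST : S * T = 1 := mul_eq_one_comm.mp hTS
  have h1 : T *ᵥ (u • ((S * S) *ᵥ y)) = u • (S *ᵥ y) := by
    rw [Matrix.mulVec_smul, Matrix.mulVec_mulVec, ← Matrix.mul_assoc, hTS, Matrix.one_mul]
  have h2 : altForm x (S *ᵥ y) = S.det * altForm (T *ᵥ x) y := by
    have := altForm_mulVec S (T *ᵥ x) y
    rwa [Matrix.mulVec_mulVec, hST, Matrix.one_mulVec] at this
  unfold twistForm
  rw [h1, altForm_smul_right, h2, altForm_swap (T *ᵥ x) y]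
  have h3 : ε * (u * S.det) = 1 := by rw [hu, hε]
  linear_combination (altForm (T *ᵥ x) y) * h3

/-- The sign in the `(−1)^e` normalisation: with `u · det S = (−1)^e`,
`B'(y, x) = (−1)^{e+1} · B'(x, σ(s²) y)`. -/
theorem twistForm_sign_pow (S T : Matrix (Fin 2) (Fin 2) R) (hTS : T * S = 1) (u : R) (e : ℕ)
    (hu : u * S.det = (-1) ^ e) (x y : Fin 2 → R) :
    twistForm T y x = (-1) ^ (e + 1) * twistForm T x (u • ((S * S) *ᵥ y)) := by
  have hε : ((-1 : R) ^ e) * ((-1 : R) ^ e) = 1 := by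
    rw [← mul_pow, neg_one_mul, neg_neg, one_pow]
  rw [twistForm_sign S T hTS u ((-1) ^ e) hu hε x y, pow_succ]
  ring

/-- Sanity instance `ω = 1`, `μ = 1` (`e = 0`): `ρ` valued in `SL₂`, `u = 1`, `det S = 1`; the sign is
`−1` (conjugate-SYMPLECTIC), as for any representation into `SL₂ = Sp₂`. -/
example (S T : Matrix (Fin 2) (Fin 2) R) (hTS : T * S = 1) (hS : S.det = 1) (x y : Fin 2 → R) :
    twistForm T y x = -twistForm T x ((S * S) *ᵥ y) := by
  have := twistForm_sign S T hTS 1 1 (by rw [hS, one_mul]) (one_mul 1) x y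
  simpa using this

end Form

section Bookkeeping

/-- **PARITY BOOKKEEPING of W♭-U (U2)** over `ZMod 2`.  Variables: `t = [ρ odd]`, `k` = weight of
`μ_∞ = χ_k`, `e` as above, `N` = rank of the unitary group, `a` = the `SL₂`-dimension of the block.
Hypotheses: `k = t + e` (archimedean restriction of `μ|_{𝔸_ℚ^×} = ω⁻¹ η^e`) and `e = N − 1 − a`
(`Ψ₂(U_N)`: sign `(−1)^{e+1} (−1)^{a−1} = (−1)^{N−1}`).  Conclusion: the exponents
`(k + a − 1)/2 + ℤ` meet the integral coset `(N − 1)/2 + ℤ` — `k + a − 1 = N − 1 (mod 2)` — iff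
`t = 1`, i.e. iff `ρ` is ODD. -/
theorem cosetMatch_iff_odd :
    ∀ k a N e t : ZMod 2, k = t + e → e = N - 1 - a → (k + a - 1 = N - 1 ↔ t = 1) := by
  decide

/-- The same with the OPPOSITE base-change embedding `ξ_{χ_−}` (`χ_−|_{𝔸_ℚ^×} = η`, so `χ_{−,∞} = χ_{k'}`
with `k'` odd, [Mok2012, §2.1]): the required sign becomes `(−1)^N` (`e = N − a`) and the `U_N`-parameter's
exponents are those of the `GL_N(K_∞)`-block shifted by `k'/2`; the verdict is unchanged (`t = 1`).
A consistency check that the lock does not depend on the choice of `κ`. -/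
theorem cosetMatch_iff_odd_twisted :
    ∀ k k' a N e t : ZMod 2, k = t + e → e = N - a → k' = 1 →
      (k + k' + a - 1 = N - 1 ↔ t = 1) := by
  decide

end Bookkeeping

end Summit.Langlands.Langlands.Theorems.SoloBlind
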